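/-
Copyright (c) 2026 the pub-hodgecm-mathlib formalisation cell (harness21).  Prover seat hodgecm-mathlib-K2Liu-p14 (g2): Track B «K2-LIT»,
hLiu418 = stmt-HodgeConjecture-24832; K2E5-plan (g7) 10:32:10Z «(β4-v) IS YOURS» (LEAD F0P6-plan lineage RULINGS M-157b (β4)∕(β5), M-157d (K∞-str)), file (β4-v) C.
-/
import Summits.HodgeConjecture.HodgeConjecture.Theorems.K2LiuCompactUnitaryFiniteFunctionsPolynomial   -- ★ (K∞-str) engine F1 + F2's degree lemmas
import Literature.NumberTheory.Automorphic.AdelicGLnGlueProofs                                        -- ★ `isCompact_Kinf_holds` (`K_∞` compact)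
import Mathlib.NumberTheory.NumberField.InfinitePlace.TotallyRealComplex
import HarnessLib

/-!
# Crux `HLiu418`, road `K2_Liu`, Road Φ organ G5 (β) «Godement sections exhaust», file (β4-v) C:
# `K_∞`-FINITE CONTINUOUS FUNCTIONS ON `K_∞ = U(2, mixedSpace L)` ARE POLYNOMIAL IN THE COMPLEX ENTRIES AND THEIR CONJUGATES (totally complex `L`)

Cell `hodgecm-mathlib`, crux item hLiu418 = `stmt-HodgeConjecture-24832`; prover K2Liu-p14 (g2).  THEOREMS ONLY (no `def`, no instance, no notation,
no named-fact hypothesis, no `sorry`); lane `--supports stmt-HodgeConjecture-24832` (count-neutral helper).  The `hF` face of ★ (β4-iv) B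
`K2LiuGL2GodementSectionOfFlatArchCM.exists_godement_arch_of_flat_polynomial_cm` DISCHARGED from `K_∞`-finiteness: the (K∞-str) face of K2Liu-p05 ★
`K2LiuCompactUnitaryFiniteFunctionsPolynomial.exists_mvPolynomial_of_finiteDimensional_span_rightTranslates` (closed subgroups of `U(n, ℂ)`) RE-RUN on the compact
group `U(n, A)`, `A = mixedSpace L = K_∞` for a totally complex `L` (so `U(n, A) = ∏_v U(n, ℂ)` is the archimedean maximal compact `Kinf n L`, ★ `Kinf_eq_unitarySubgroupGL`,
compact by ★ `isCompact_Kinf_holds`): the engine ★ F1 `exists_mem_of_finiteDimensional_span_rightTranslates` at the degree filtration of the polynomial functions in the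
COMPLEX COORDINATES `(k_{ij})_v` of the entries and their conjugates — translation stability is the same degree-`≤ 1` substitution place by place (the coordinates of
`(k k₀)_{ij}` at `v` are linear in those of `k` at `v`), `star`-stability and products as in ★ F2, and the complex coordinates separate the points because `L` has no real
place.  MAIN **`exists_mvPolynomial_of_finiteDimensional_span_rightTranslates_mixedSpace`**.
[cite: BrockerTomDieck1985, III (1.5), III Thm. (3.1), VI] [cite: Chevalley1946, Ch. VI §VIII–IX] [cite: OnishchikVinberg1990, Ch. 5 §2 Thm. 5].
HONEST LABEL.  `HC_CM` is proved only modulo the 7 printed citations (2 remaining named inputs: hLiu418 = `stmt-HodgeConjecture-24832`,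
h413 = `stmt-HodgeConjecture-24833`) until rung 0 closes.
-/

set_option autoImplicit false
set_option linter.dupNamespace false -- the mandated namespace repeats `HodgeConjecture.HodgeConjecture`

noncomputable section

open NumberField NumberField.InfinitePlace NumberField.mixedEmbedding MeasureTheory
open scoped ComplexConjugate Classical
open Literature.NumberTheory.Automorphic
open Summit.HodgeConjecture.HodgeConjecture.Cruxes.HLiu418.K2LiuCompactGroupFiniteFunctions

namespace Summit.HodgeConjecture.HodgeConjecture.Cruxes.HLiu418.K2LiuUnitaryMixedSpaceFiniteFunctionsPolynomial

variable {L : Type} [Field L] [NumberField L] {n : Type} [Fintype n] [DecidableEq n]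

/-- **`U(n, K_∞)` is compact**: as a set of matrices it is the image of the archimedean maximal compact `Kinf n L = U(n, mixedSpace L) ≤ GL_n(K_∞)`
(★ `Kinf_eq_unitarySubgroupGL`, ★ `isCompact_Kinf_holds`) under `Units.val`. [cite: BrockerTomDieck1985, III (3.1)] -/
theorem isCompact_unitaryGroup_mixedSpace (m : ℕ) : IsCompact (Matrix.unitaryGroup (Fin m) (mixedSpace L) : Set (Matrix (Fin m) (Fin m) (mixedSpace L))) := by
  have h1 : (Matrix.unitaryGroup (Fin m) (mixedSpace L) : Set (Matrix (Fin m) (Fin m) (mixedSpace L))) =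
      Units.val '' (Kinf m L : Set (GL (Fin m) (mixedSpace L))) := by
    ext M
    constructor
    · intro hM
      refine ⟨⟨M, star M, Matrix.mem_unitaryGroup_iff.1 hM, Matrix.mem_unitaryGroup_iff'.1 hM⟩, ?_, rfl⟩
      rw [SetLike.mem_coe, Kinf_eq_unitarySubgroupGL, mem_unitarySubgroupGL_iff_coe_mem_unitaryGroup]
      exact hM
    · rintro ⟨g, hg, rfl⟩
      rw [SetLike.mem_coe, Kinf_eq_unitarySubgroupGL, mem_unitarySubgroupGL_iff_coe_mem_unitaryGroup] at hg
      exact hg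
  rw [h1]
  exact (isCompact_Kinf_holds m L).image Units.continuous_val

variable [IsTotallyComplex L]

omit [NumberField L] in
/-- in a totally complex `K_∞` a matrix is determined by the complex coordinates of its entries. [folklore] -/
theorem matrix_eq_of_forall_snd_eq {m : Type} {M N : Matrix m m (mixedSpace L)}
    (h : ∀ (v : {v : InfinitePlace L // v.IsComplex}) (i j : m), (M i j).2 v = (N i j).2 v) : M = N := by
  haveI : IsEmpty {w : InfinitePlace L // w.IsReal} := ⟨fun w => (not_isReal_iff_isComplex.2 (IsTotallyComplex.isComplex w.1)) w.2⟩
  exact Matrix.ext fun i j => Prod.ext (Subsingleton.elim _ _) (funext fun v => h v i j)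

/-- **`K_∞`-FINITE CONTINUOUS FUNCTIONS ON `U(m, K_∞)` ARE POLYNOMIAL IN THE COMPLEX COORDINATES OF THE ENTRIES AND THEIR CONJUGATES** (totally complex `L`;
the (K∞-str) face of K2Liu-p05 for the compact group `U(m, mixedSpace L) = ∏_v U(m, ℂ)`).  For a continuous `f : U(m, mixedSpace L) → ℂ` whose right translates
`k ↦ f (k k₀)` span a finite-dimensional space there is a complex polynomial `P` in the letters `x_{v,ij}`, `x̄_{v,ij}` (`v` complex place) with
`f k = P(((k_{ij})_v)_{v,ij}, conj)` for every `k` — ★ engine F1 at the degree filtration in the complex coordinates (this is the `hF` face of ★ (β4-iv) B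
`exists_godement_arch_of_flat_polynomial_cm`). [cite: BrockerTomDieck1985, III (1.5) and Thm. (3.1)] [cite: Chevalley1946, Ch. VI §VIII] [cite: OnishchikVinberg1990, Ch. 5 §2 Thm. 5] -/
theorem exists_mvPolynomial_of_finiteDimensional_span_rightTranslates_mixedSpace {m : ℕ}
    (f : Matrix.unitaryGroup (Fin m) (mixedSpace L) → ℂ) (hf : Continuous f)
    (hfin : FiniteDimensional ℂ (Submodule.span ℂ (Set.range fun k₀ : Matrix.unitaryGroup (Fin m) (mixedSpace L) =>
      fun k : Matrix.unitaryGroup (Fin m) (mixedSpace L) => f (k * k₀)))) :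
    ∃ P : MvPolynomial (({v : InfinitePlace L // v.IsComplex} × (Fin m × Fin m)) ⊕ ({v : InfinitePlace L // v.IsComplex} × (Fin m × Fin m))) ℂ,
      ∀ k : Matrix.unitaryGroup (Fin m) (mixedSpace L), f k = MvPolynomial.eval
        (Sum.elim (fun w : {v : InfinitePlace L // v.IsComplex} × (Fin m × Fin m) => ((k : Matrix (Fin m) (Fin m) (mixedSpace L)) w.2.1 w.2.2).2 w.1)
          (fun w : {v : InfinitePlace L // v.IsComplex} × (Fin m × Fin m) => conj (((k : Matrix (Fin m) (Fin m) (mixedSpace L)) w.2.1 w.2.2).2 w.1))) P := by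
  -- the compact group `K = U(m, K_∞)`
  haveI : CompactSpace (Matrix.unitaryGroup (Fin m) (mixedSpace L)) := isCompact_iff_compactSpace.mp (isCompact_unitaryGroup_mixedSpace m)
  letI : MeasurableSpace (Matrix.unitaryGroup (Fin m) (mixedSpace L)) := borel _
  haveI : BorelSpace (Matrix.unitaryGroup (Fin m) (mixedSpace L)) := ⟨rfl⟩
  -- the coordinate functions and the evaluation `Φ = aeval gen`
  let mat : Matrix.unitaryGroup (Fin m) (mixedSpace L) → Matrix (Fin m) (Fin m) (mixedSpace L) := fun k => (k : Matrix (Fin m) (Fin m) (mixedSpace L))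
  have hmat : Continuous mat := continuous_subtype_val
  have hmat_mul : ∀ k k' : Matrix.unitaryGroup (Fin m) (mixedSpace L), mat (k * k') = mat k * mat k' := fun k k' => rfl
  have hcoord : ∀ (v : {v : InfinitePlace L // v.IsComplex}) (i j : Fin m), Continuous fun k : Matrix.unitaryGroup (Fin m) (mixedSpace L) => (mat k i j).2 v :=
    fun v i j => (continuous_apply v).comp (continuous_snd.comp (hmat.matrix_elem i j))
  let vals : Matrix.unitaryGroup (Fin m) (mixedSpace L) →
      (({v : InfinitePlace L // v.IsComplex} × (Fin m × Fin m)) ⊕ ({v : InfinitePlace L // v.IsComplex} × (Fin m × Fin m))) → ℂ := fun k =>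
    Sum.elim (fun w => (mat k w.2.1 w.2.2).2 w.1) (fun w => conj ((mat k w.2.1 w.2.2).2 w.1))
  let gen : (({v : InfinitePlace L // v.IsComplex} × (Fin m × Fin m)) ⊕ ({v : InfinitePlace L // v.IsComplex} × (Fin m × Fin m))) →
      C(Matrix.unitaryGroup (Fin m) (mixedSpace L), ℂ) := fun c =>
    match c with
    | Sum.inl w => ⟨fun k => (mat k w.2.1 w.2.2).2 w.1, hcoord w.1 w.2.1 w.2.2⟩
    | Sum.inr w => ⟨fun k => conj ((mat k w.2.1 w.2.2).2 w.1), Complex.continuous_conj.comp (hcoord w.1 w.2.1 w.2.2)⟩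
  have hgen : ∀ c k, gen c k = vals k c := fun c k => by
    rcases c with w | w <;> rfl
  let Φ : MvPolynomial (({v : InfinitePlace L // v.IsComplex} × (Fin m × Fin m)) ⊕ ({v : InfinitePlace L // v.IsComplex} × (Fin m × Fin m))) ℂ →ₐ[ℂ]
      C(Matrix.unitaryGroup (Fin m) (mixedSpace L), ℂ) := MvPolynomial.aeval gen
  have hΦ : ∀ (P : MvPolynomial (({v : InfinitePlace L // v.IsComplex} × (Fin m × Fin m)) ⊕ ({v : InfinitePlace L // v.IsComplex} × (Fin m × Fin m))) ℂ)
      (k : Matrix.unitaryGroup (Fin m) (mixedSpace L)), Φ P k = MvPolynomial.eval (vals k) P := by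
    intro P k
    have h1 : (ContinuousMap.evalAlgHom ℂ ℂ k).comp Φ = MvPolynomial.aeval (vals k) := by
      rw [MvPolynomial.comp_aeval]
      congr 1
      funext c
      exact hgen c k
    have h2 : Φ P k = MvPolynomial.aeval (vals k) P := by
      have h3 := congrArg (fun ψ : MvPolynomial _ ℂ →ₐ[ℂ] ℂ => ψ P) h1
      simpa only [AlgHom.comp_apply, ContinuousMap.evalAlgHom_apply] using h3
    rw [h2]
    exact congrFun (MvPolynomial.aeval_eq_eval (vals k)) P
  -- the degree filtration
  let A : ℕ → Submodule ℂ C(Matrix.unitaryGroup (Fin m) (mixedSpace L), ℂ) := fun d =>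
    (MvPolynomial.restrictTotalDegree (({v : InfinitePlace L // v.IsComplex} × (Fin m × Fin m)) ⊕ ({v : InfinitePlace L // v.IsComplex} × (Fin m × Fin m))) ℂ d).map
      Φ.toLinearMap
  have hAmem : ∀ d (a : C(Matrix.unitaryGroup (Fin m) (mixedSpace L), ℂ)), a ∈ A d ↔
      ∃ P : MvPolynomial (({v : InfinitePlace L // v.IsComplex} × (Fin m × Fin m)) ⊕ ({v : InfinitePlace L // v.IsComplex} × (Fin m × Fin m))) ℂ,
        P.totalDegree ≤ d ∧ Φ P = a := fun d a => by
    simp only [A, Submodule.mem_map, MvPolynomial.mem_restrictTotalDegree, AlgHom.toLinearMap_apply]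
  have hmono : Monotone A := fun d d' hdd' a ha => by
    obtain ⟨P, hP, rfl⟩ := (hAmem d a).1 ha
    exact (hAmem d' _).2 ⟨P, hP.trans hdd', rfl⟩
  have hAfin : ∀ d, FiniteDimensional ℂ (A d) := fun d => inferInstance
  -- substitution by degree-≤ 1 forms keeps the degree; the coordinates of `k k₀` and `y k`
  have hsubst : ∀ d (Λ : (({v : InfinitePlace L // v.IsComplex} × (Fin m × Fin m)) ⊕ ({v : InfinitePlace L // v.IsComplex} × (Fin m × Fin m))) →
      MvPolynomial (({v : InfinitePlace L // v.IsComplex} × (Fin m × Fin m)) ⊕ ({v : InfinitePlace L // v.IsComplex} × (Fin m × Fin m))) ℂ)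
      (_ : ∀ c, (Λ c).totalDegree ≤ 1) (P : MvPolynomial _ ℂ), P.totalDegree ≤ d → (MvPolynomial.bind₁ Λ P).totalDegree ≤ d :=
    fun d Λ hΛ P hP => (Literature.RepresentationTheory.CompactGroups.totalDegree_bind₁_le_of_forall_le_one Λ hΛ P).trans hP
  have hbind : ∀ (Λ : (({v : InfinitePlace L // v.IsComplex} × (Fin m × Fin m)) ⊕ ({v : InfinitePlace L // v.IsComplex} × (Fin m × Fin m))) →
      MvPolynomial (({v : InfinitePlace L // v.IsComplex} × (Fin m × Fin m)) ⊕ ({v : InfinitePlace L // v.IsComplex} × (Fin m × Fin m))) ℂ)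
      (g : Matrix.unitaryGroup (Fin m) (mixedSpace L) → Matrix.unitaryGroup (Fin m) (mixedSpace L)) (hg : Continuous g),
      (∀ c k, MvPolynomial.eval (vals k) (Λ c) = vals (g k) c) →
      ∀ P : MvPolynomial _ ℂ, Φ (MvPolynomial.bind₁ Λ P) = (Φ P).comp ⟨g, hg⟩ := by
    intro Λ g hg hΛg P
    ext k
    rw [ContinuousMap.comp_apply, hΦ, hΦ, Literature.NumberTheory.Automorphic.eval_bind₁]
    exact congrArg (fun F : _ → ℂ => MvPolynomial.eval F P) (funext fun c => hΛg c k)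
  -- the complex coordinates of a product, place by place
  have hmul_snd : ∀ (k k' : Matrix.unitaryGroup (Fin m) (mixedSpace L)) (i j : Fin m) (v : {v : InfinitePlace L // v.IsComplex}),
      (mat (k * k') i j).2 v = ∑ l, (mat k i l).2 v * (mat k' l j).2 v := by
    intro k k' i j v
    rw [hmat_mul, Matrix.mul_apply, Prod.snd_sum, Finset.sum_apply]
    rfl
  -- (3) right translation
  have hright : ∀ d (k₀ : Matrix.unitaryGroup (Fin m) (mixedSpace L)) (a : C(Matrix.unitaryGroup (Fin m) (mixedSpace L), ℂ)),
      a ∈ A d → a.comp (ContinuousMap.mulRight k₀) ∈ A d := by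
    intro d k₀ a ha
    obtain ⟨P, hP, rfl⟩ := (hAmem d a).1 ha
    let Λ : (({v : InfinitePlace L // v.IsComplex} × (Fin m × Fin m)) ⊕ ({v : InfinitePlace L // v.IsComplex} × (Fin m × Fin m))) →
        MvPolynomial (({v : InfinitePlace L // v.IsComplex} × (Fin m × Fin m)) ⊕ ({v : InfinitePlace L // v.IsComplex} × (Fin m × Fin m))) ℂ := fun c =>
      match c with
      | Sum.inl w => ∑ l : Fin m, MvPolynomial.X (Sum.inl (w.1, (w.2.1, l))) * MvPolynomial.C ((mat k₀ l w.2.2).2 w.1)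
      | Sum.inr w => ∑ l : Fin m, MvPolynomial.X (Sum.inr (w.1, (w.2.1, l))) * MvPolynomial.C (conj ((mat k₀ l w.2.2).2 w.1))
    have hΛ : ∀ c, (Λ c).totalDegree ≤ 1 := fun c => by
      rcases c with w | w
      · exact totalDegree_sum_X_mul_C_le _ _
      · exact totalDegree_sum_X_mul_C_le _ _
    have hΛg : ∀ c k, MvPolynomial.eval (vals k) (Λ c) = vals (k * k₀) c := fun c k => by
      rcases c with ⟨v, i, j⟩ | ⟨v, i, j⟩
      · simp only [Λ, vals, map_sum, map_mul, MvPolynomial.eval_X, MvPolynomial.eval_C, Sum.elim_inl, hmul_snd]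
      · simp only [Λ, vals, map_sum, map_mul, MvPolynomial.eval_X, MvPolynomial.eval_C, Sum.elim_inr, hmul_snd]
    refine (hAmem d _).2 ⟨MvPolynomial.bind₁ Λ P, hsubst d Λ hΛ P hP, ?_⟩
    rw [hbind Λ (fun k => k * k₀) (continuous_mul_const k₀) hΛg P]
    rfl
  -- (4) left translation
  have hleft : ∀ d (y : Matrix.unitaryGroup (Fin m) (mixedSpace L)) (a : C(Matrix.unitaryGroup (Fin m) (mixedSpace L), ℂ)),
      a ∈ A d → a.comp (ContinuousMap.mulLeft y) ∈ A d := by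
    intro d y a ha
    obtain ⟨P, hP, rfl⟩ := (hAmem d a).1 ha
    let Λ : (({v : InfinitePlace L // v.IsComplex} × (Fin m × Fin m)) ⊕ ({v : InfinitePlace L // v.IsComplex} × (Fin m × Fin m))) →
        MvPolynomial (({v : InfinitePlace L // v.IsComplex} × (Fin m × Fin m)) ⊕ ({v : InfinitePlace L // v.IsComplex} × (Fin m × Fin m))) ℂ := fun c =>
      match c with
      | Sum.inl w => ∑ l : Fin m, MvPolynomial.C ((mat y w.2.1 l).2 w.1) * MvPolynomial.X (Sum.inl (w.1, (l, w.2.2)))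
      | Sum.inr w => ∑ l : Fin m, MvPolynomial.C (conj ((mat y w.2.1 l).2 w.1)) * MvPolynomial.X (Sum.inr (w.1, (l, w.2.2)))
    have hΛ : ∀ c, (Λ c).totalDegree ≤ 1 := fun c => by
      rcases c with w | w
      · exact totalDegree_sum_C_mul_X_le _ _
      · exact totalDegree_sum_C_mul_X_le _ _
    have hΛg : ∀ c k, MvPolynomial.eval (vals k) (Λ c) = vals (y * k) c := fun c k => by
      rcases c with ⟨v, i, j⟩ | ⟨v, i, j⟩
      · simp only [Λ, vals, map_sum, map_mul, MvPolynomial.eval_X, MvPolynomial.eval_C, Sum.elim_inl, hmul_snd]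
      · simp only [Λ, vals, map_sum, map_mul, MvPolynomial.eval_X, MvPolynomial.eval_C, Sum.elim_inr, hmul_snd]
    refine (hAmem d _).2 ⟨MvPolynomial.bind₁ Λ P, hsubst d Λ hΛ P hP, ?_⟩
    rw [hbind Λ (fun k => y * k) (continuous_const_mul y) hΛg P]
    rfl
  -- (5) star
  have hstar : ∀ d (a : C(Matrix.unitaryGroup (Fin m) (mixedSpace L), ℂ)), a ∈ A d → star a ∈ A d := by
    intro d a ha
    obtain ⟨P, hP, rfl⟩ := (hAmem d a).1 ha
    refine (hAmem d _).2 ⟨MvPolynomial.rename Sum.swap (MvPolynomial.map (starRingEnd ℂ) P),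
      (MvPolynomial.totalDegree_rename_le _ _).trans ((totalDegree_map_le _ P).trans hP), ?_⟩
    ext k
    rw [hΦ, MvPolynomial.eval_rename, MvPolynomial.eval_map, ContinuousMap.star_apply, hΦ, Complex.star_def,
      ← MvPolynomial.eval₂_id, MvPolynomial.hom_eval₂, (starRingEnd ℂ).comp_id]
    congr 1
    funext c
    rcases c with w | w
    · rfl
    · exact (Complex.conj_conj _).symm
  -- (6) one, (7) products
  have hone : ∃ d, (1 : C(Matrix.unitaryGroup (Fin m) (mixedSpace L), ℂ)) ∈ A d := ⟨0, (hAmem 0 1).2 ⟨1, MvPolynomial.totalDegree_one.le, map_one Φ⟩⟩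
  have hmul : ∀ d d' (a b : C(Matrix.unitaryGroup (Fin m) (mixedSpace L), ℂ)), a ∈ A d → b ∈ A d' → ∃ d'', a * b ∈ A d'' := by
    intro d d' a b ha hb
    obtain ⟨P, hP, rfl⟩ := (hAmem d a).1 ha
    obtain ⟨Q, hQ, rfl⟩ := (hAmem d' b).1 hb
    exact ⟨d + d', (hAmem _ _).2 ⟨P * Q, (MvPolynomial.totalDegree_mul P Q).trans (add_le_add hP hQ), map_mul Φ P Q⟩⟩
  -- (8) the complex coordinates separate the points (no real place)
  have hsep : ∀ x y : Matrix.unitaryGroup (Fin m) (mixedSpace L), x ≠ y → ∃ d, ∃ a ∈ A d, a x ≠ a y := by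
    intro x y hxy
    obtain ⟨v, i, j, hij⟩ : ∃ v i j, (mat x i j).2 v ≠ (mat y i j).2 v := by
      by_contra! h
      exact hxy (Subtype.ext (matrix_eq_of_forall_snd_eq h))
    refine ⟨1, Φ (MvPolynomial.X (Sum.inl (v, (i, j)))), (hAmem 1 _).2 ⟨_, (MvPolynomial.totalDegree_X (R := ℂ) _).le, rfl⟩, ?_⟩
    rw [hΦ, hΦ, MvPolynomial.eval_X, MvPolynomial.eval_X]
    exact hij
  -- the right-finiteness hypothesis, transported to `C(K, ℂ)`
  set F : C(Matrix.unitaryGroup (Fin m) (mixedSpace L), ℂ) := ⟨f, hf⟩ with hFdef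
  have hW : FiniteDimensional ℂ (Submodule.span ℂ (Set.range fun k₀ : Matrix.unitaryGroup (Fin m) (mixedSpace L) => F.comp (ContinuousMap.mulRight k₀))) := by
    have hinj : Function.Injective (ContinuousMap.coeFnLinearMap ℂ : C(Matrix.unitaryGroup (Fin m) (mixedSpace L), ℂ) →ₗ[ℂ] _ → ℂ) :=
      fun a b h => ContinuousMap.ext (congrFun h)
    have hmap : (Submodule.span ℂ (Set.range fun k₀ : Matrix.unitaryGroup (Fin m) (mixedSpace L) => F.comp (ContinuousMap.mulRight k₀))).map
        (ContinuousMap.coeFnLinearMap ℂ) = Submodule.span ℂ (Set.range fun k₀ : Matrix.unitaryGroup (Fin m) (mixedSpace L) =>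
          fun k : Matrix.unitaryGroup (Fin m) (mixedSpace L) => f (k * k₀)) := by
      rw [Submodule.map_span, ← Set.range_comp]
      rfl
    haveI : FiniteDimensional ℂ ((Submodule.span ℂ (Set.range fun k₀ : Matrix.unitaryGroup (Fin m) (mixedSpace L) =>
        F.comp (ContinuousMap.mulRight k₀))).map (ContinuousMap.coeFnLinearMap ℂ)) := by
      rw [hmap]
      exact hfin
    exact LinearEquiv.finiteDimensional (Submodule.equivMapOfInjective _ hinj _).symm
  -- the engine
  obtain ⟨d, hd⟩ := exists_mem_of_finiteDimensional_span_rightTranslates A hmono hAfin hleft hright hstar hone hmul hsep F hW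
  obtain ⟨P, -, hP⟩ := (hAmem d F).1 hd
  refine ⟨P, fun k => ?_⟩
  rw [← hΦ, hP]
  rfl

end Summit.HodgeConjecture.HodgeConjecture.Cruxes.HLiu418.K2LiuUnitaryMixedSpaceFiniteFunctionsPolynomial

end
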